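import Summits.HodgeConjecture.HodgeConjecture.Theorems.K2LiuSiegelDeltaHeightExists        -- ★ p854993 (K2Liu-p07): `continuous_vecHeight_vecMul_compound` (+ ★ p09 height of record)
import Summits.HodgeConjecture.HodgeConjecture.Theorems.K2LiuSiegelDoubledIwasawaCompact     -- ★ (I) `exists_isCompact_isSiegelDelta_mul`
import Summits.HodgeConjecture.HodgeConjecture.Theorems.K2LiuDoublingHeightComparison        -- ★ p854882: `exists_pos_forall_le_mul`
import Summits.HodgeConjecture.HodgeConjecture.Theorems.K2LiuAdelicHeightGLVsVecHeight       -- ★ F3 (p855092): `adelicHeightGL_le_vecHeight`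
import Summits.HodgeConjecture.HodgeConjecture.Theorems.K2LiuDoublingPluckerCoordinates      -- ★ F4 (p854989): `exists_compound_fromCols_neg_one_norm_eq_one ∕ _entry`
import Summits.HodgeConjecture.HodgeConjecture.Theorems.K2LiuUnitaryInverseHeight            -- ★ F5 (p855047): `vecHeight_one_entries_inv_le`
import HarnessLib

/-!
# Crux `HLiu418`, Track B road `K2_Liu`, unit U5 «DOUBLING ZETA» — socket #16a `sig_K2LiuDoublingHeightDecayPointwise` (organ (IV-c)):
# a `P_Δ`-height decays along the doubling embedding, `Φ(ι(g,1)) ≤ C · ‖g‖^{-α}`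

Cell `hodgecm-mathlib`, crux item hLiu418 = `stmt-HodgeConjecture-24832`, route of record `HCCMUnconditional`; squad K2 ∕ K2Liu, prover K2Liu-p04 (g0).
Socket #16a of `Cruxes/HLiu418/Lines/K2_Liu_CurveThetaSigs_U5_DoublingZeta.lean`, U5 ED. 6 (5cff0c75aa6afdae) :242 — statement below BYTE-IDENTICAL
(`[NeZero N]` edition, K2Liu-ref1 BOX #9 ∕ LEAD RULING 21:51:22Z (A)); THEOREMS ONLY; lane `--supports stmt-HodgeConjecture-24832 --as helper`.

THE ARGUMENT ([GelbartPiatetskishapiroRallis1987, Part A §2]; [Liu2021, Lem. B.10 (2) p. 102]; [BorelJacquet1979, §1.2]).  `h = vecHeight` (★ `AdelicVectorHeight`),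
`Φ₀(x) = h(π(x))^{-1∕2}` the Plücker height of record (★ p09 `K2LiuSiegelDoubledPluckerHeight`; `π(x)` = the maximal minors of `R₀ · x`), continuous (★ p07),
positive, of type `(P_Δ, modDelta)` (§4 re-runs the verification for the NAMED formula).  For `g ∈ U(V)(𝔸)`: §2 `R₀ · ι(g,1) = [G | −1] ∘ e₂⁻¹`, `G = g ⊗ 1`
re-enumerated (★ `coe_iotaGG`), so place by place `1` and `g_{ij}` are Plücker coordinates of `ι(g,1)` in absolute value (★ F4, §3), whence
`h(1,(g_{ij})) ≤ C₁ h(π(ι(g,1)))` (§1); ★ F5 `h(1,g,g⁻¹) ≤ C₂ h(1,g)²`; ★ F3 `‖g‖ ≤ h(1,g,g⁻¹)`; so `Φ₀(ι(g,1)) ≤ (C₂C₁²)^{1∕4} ‖g‖^{-1∕4}` (§4); an arbitrary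
continuous positive `Φ` of the same type is `≤ C' Φ₀` (★ p854882 over the Iwasawa decomposition ★ (I)), whence #16a with `α = 1∕4` (§5).

HONEST LABEL.  `HC_CM` is proved only modulo the 7 printed citations (2 remaining named inputs: hLiu418 = `stmt-HodgeConjecture-24832`, h413 =
`stmt-HodgeConjecture-24833`) until rung 0 closes; this file pays ONE tier-1 socket (#16a) by name and retires nothing else.
-/

set_option autoImplicit false
-- the mandated namespace repeats the single-problem summit's segment (`HodgeConjecture.HodgeConjecture`)
set_option linter.dupNamespace false

noncomputable section

open scoped Matrix NNReal Kronecker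
open NumberField IsDedekindDomain

namespace Summit.HodgeConjecture.HodgeConjecture.Cruxes.HLiu418.K2LiuDoublingHeightDecayPointwise

open Literature.NumberTheory.Automorphic Literature.NumberTheory.Automorphic.UnitaryGroup
open Literature.NumberTheory.GelbartRogawski1991 Literature.NumberTheory.GelbartRogawski1991.GRConstruction
open Literature.NumberTheory.K2Lit.SiegelDoubled
open Literature.LinearAlgebra.Matrix
open Summit.HodgeConjecture.HodgeConjecture.Cruxes.HLiu418.K2LiuSiegelDoubledPluckerFrame
open Summit.HodgeConjecture.HodgeConjecture.Cruxes.HLiu418.K2LiuSiegelDoubledPluckerHeight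
open Summit.HodgeConjecture.HodgeConjecture.Cruxes.HLiu418.K2LiuSiegelDeltaHeightExists
open Summit.HodgeConjecture.HodgeConjecture.Cruxes.HLiu418.K2LiuDoublingPluckerCoordinates
open Summit.HodgeConjecture.HodgeConjecture.Cruxes.HLiu418.K2LiuUnitaryInverseHeight
open Summit.HodgeConjecture.HodgeConjecture.Cruxes.HLiu418.K2LiuAdelicHeightGLVsVecHeight

/-! ## §1 From local dominations to a global height bound -/

section Local

variable {K : Type} [Field K] [NumberField K] {ι κ : Type*} [Fintype ι] [Fintype κ]

/-- If every coordinate of `x` has `w`-norm at most `‖y‖_w`, then `‖x‖_w ≤ √(card ι) · ‖y‖_w` (Euclidean norm against sup of coordinates).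
[cite: Garrett2018, §2.2 (PDF p. 81)] -/
theorem vecArchNorm_le_sqrt_card_mul (w : InfinitePlace K) {x : ι → AdeleRing (𝓞 K) K} {y : κ → AdeleRing (𝓞 K) K}
    (h : ∀ i, ‖(x i).1 w‖₊ ≤ vecArchNorm K w y) :
    vecArchNorm K w x ≤ NNReal.sqrt (Fintype.card ι) * vecArchNorm K w y := by
  set B := vecArchNorm K w y with hB
  show NNReal.sqrt (∑ i, ‖(x i).1 w‖₊ ^ 2) ≤ _
  calc NNReal.sqrt (∑ i, ‖(x i).1 w‖₊ ^ 2) ≤ NNReal.sqrt (∑ _i : ι, B ^ 2) :=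
        NNReal.sqrt_le_sqrt.2 (Finset.sum_le_sum fun i _ => pow_le_pow_left' (h i) 2)
    _ = NNReal.sqrt (Fintype.card ι) * B := by
        rw [Finset.sum_const, Finset.card_univ, nsmul_eq_mul, NNReal.sqrt_mul, NNReal.sqrt_sq]

/-- **Local-to-global.**  If `h_v(x) ≤ h_v(y)` at every finite place and every coordinate of `x` has `w`-norm at most `‖y‖_w` at every infinite
place, then `h(x) ≤ (∏_w √(card ι)^{mult w}) · h(y)` (for vectors with finite height data). [cite: Garrett2018, §2.2 (PDF p. 81)] -/
theorem vecHeight_le_of_local {x : ι → AdeleRing (𝓞 K) K} {y : κ → AdeleRing (𝓞 K) K} (hx : IsHeightFinite K x)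
    (hy : IsHeightFinite K y) (hfin : ∀ v, vecFinHeight K v x ≤ vecFinHeight K v y)
    (harch : ∀ (w : InfinitePlace K) (i : ι), ‖(x i).1 w‖₊ ≤ vecArchNorm K w y) :
    vecHeight K x ≤ (∏ w : InfinitePlace K, NNReal.sqrt (Fintype.card ι) ^ w.mult) * vecHeight K y := by
  unfold vecHeight
  have h1 : ∏ w : InfinitePlace K, vecArchNorm K w x ^ w.mult ≤
      ∏ w : InfinitePlace K, (NNReal.sqrt (Fintype.card ι) * vecArchNorm K w y) ^ w.mult :=
    Finset.prod_le_prod' fun w _ => pow_le_pow_left' (vecArchNorm_le_sqrt_card_mul w (harch w)) _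
  have h2 : ∏ᶠ v, vecFinHeight K v x ≤ ∏ᶠ v, vecFinHeight K v y := finprod_le_finprod' hx hy fun v => hfin v
  calc (∏ w : InfinitePlace K, vecArchNorm K w x ^ w.mult) * ∏ᶠ v, vecFinHeight K v x
      ≤ (∏ w : InfinitePlace K, (NNReal.sqrt (Fintype.card ι) * vecArchNorm K w y) ^ w.mult) * ∏ᶠ v, vecFinHeight K v y :=
        mul_le_mul' h1 h2
    _ = (∏ w : InfinitePlace K, NNReal.sqrt (Fintype.card ι) ^ w.mult) *
          ((∏ w : InfinitePlace K, vecArchNorm K w y ^ w.mult) * ∏ᶠ v, vecFinHeight K v y) := by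
        simp_rw [mul_pow]
        rw [Finset.prod_mul_distrib, mul_assoc]

/-- A compound coordinate read at a ring homomorphism `φ` is the compound coordinate of the image matrix (★ `compound_map`). [folklore] -/
theorem map_compound_apply {R S : Type*} [CommRing R] [CommRing S] {m p : Type*} [LinearOrder m] [LinearOrder p] {k : ℕ}
    (φ : R →+* S) (A : Matrix m p R) (I : Set.powersetCard m k) (J : Set.powersetCard p k) :
    φ (compound k A I J) = compound k (A.map φ) I J := by
  rw [compound_map]; rfl

/-- The entries of `G = e ∘ (g ⊗ 1) ∘ e⁻¹` at `(e(i,0), e(j,0))` are the entries `g_{ij}`. [folklore] -/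
theorem reindex_kronecker_one_apply {R : Type*} [CommRing R] {N n : ℕ} (e : Fin N × Fin 1 ≃ Fin n) (g : Matrix (Fin N) (Fin N) R)
    (i j : Fin N) : (Matrix.reindex e e (g ⊗ₖ (1 : Matrix (Fin 1) (Fin 1) R))) (e (i, 0)) (e (j, 0)) = g i j := by
  rw [Matrix.reindex_apply, Matrix.submatrix_apply, Equiv.symm_apply_apply, Equiv.symm_apply_apply, Matrix.kronecker_apply,
    Matrix.one_apply_eq, mul_one]

end Local

/-! ## §2 The doubling element `ι(g,1)` in the frame of the height of record -/

section Doubling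

variable (L : Type) [Field L] [NumberField L] [IsCMField L]
variable {N n : ℕ} (e : Fin N × Fin 1 ≃ Fin n)
  (dV : Fin N → L) (hdV : ∀ i, IsCMField.complexConj L (dV i) = dV i)
  (dW : Fin 1 → L) (hdW : ∀ i, IsCMField.complexConj L (dW i) = dW i)

/-- **The `GL`-matrix of `ι(g,1)`**: `e₂ ∘ diag(G, 1) ∘ e₂⁻¹` with `G = e ∘ (g ⊗ 1) ∘ e⁻¹` (★ `coe_iotaGG`, ★ `coe_adelicInl`). [cite: Liu2021, §B.3 p. 101] -/
theorem coe_iotaLeft (g : UnitaryGroup.adelic (Fp L) L (IsCMField.complexConj L) N (Matrix.diagonal dV)) :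
    (((iotaLeft L e dV hdV dW hdW g : HA L e dV hdV dW hdW) : GL (Fin (n + n)) (AdeleRing (𝓞 L) L)) :
        Matrix (Fin (n + n)) (Fin (n + n)) (AdeleRing (𝓞 L) L)) =
      Matrix.reindex (e₂ (n := n)) (e₂ (n := n)) (Matrix.fromBlocks
        (Matrix.reindex e e (((g : GL (Fin N) (AdeleRing (𝓞 L) L)) : Matrix (Fin N) (Fin N) (AdeleRing (𝓞 L) L)) ⊗ₖ
          (1 : Matrix (Fin 1) (Fin 1) (AdeleRing (𝓞 L) L))))
        0 0 (1 : Matrix (Fin n) (Fin n) (AdeleRing (𝓞 L) L))) := by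
  rw [iotaLeft_apply, iotaV, MonoidHom.comp_apply, MonoidHom.coe_prodMap, Prod.map_apply, map_one, coe_iotaGG]
  rw [UnitaryGroup.coe_reindexGL, coe_blockDiagGL, OneMemClass.coe_one, map_one, Units.val_one, UnitaryGroup.coe_reindexGL,
    coe_adelicInl]

/-- **`R₀ · ι(g,1) = [G | −1] ∘ e₂⁻¹`** (`R₀ = (1 | −1) ∘ e₂⁻¹` the frame of the height of record). [cite: GelbartPiatetskishapiroRallis1987, Part A §2] -/
theorem frame_mul_coe_iotaLeft (g : UnitaryGroup.adelic (Fp L) L (IsCMField.complexConj L) N (Matrix.diagonal dV)) :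
    (Matrix.fromCols (1 : Matrix (Fin n) (Fin n) (AdeleRing (𝓞 L) L)) (-(1 : Matrix (Fin n) (Fin n) (AdeleRing (𝓞 L) L))) :
          Matrix (Fin n) (Fin n ⊕ Fin n) (AdeleRing (𝓞 L) L)).submatrix id (e₂ (n := n)).symm *
        (((iotaLeft L e dV hdV dW hdW g : HA L e dV hdV dW hdW) : GL (Fin (n + n)) (AdeleRing (𝓞 L) L)) :
          Matrix (Fin (n + n)) (Fin (n + n)) (AdeleRing (𝓞 L) L)) =
      (Matrix.fromCols
          (Matrix.reindex e e (((g : GL (Fin N) (AdeleRing (𝓞 L) L)) : Matrix (Fin N) (Fin N) (AdeleRing (𝓞 L) L)) ⊗ₖ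
            (1 : Matrix (Fin 1) (Fin 1) (AdeleRing (𝓞 L) L))))
          (-(1 : Matrix (Fin n) (Fin n) (AdeleRing (𝓞 L) L))) : Matrix (Fin n) (Fin n ⊕ Fin n) (AdeleRing (𝓞 L) L)).submatrix
        id (e₂ (n := n)).symm := by
  rw [coe_iotaLeft, Matrix.reindex_apply, Matrix.submatrix_mul_equiv, Matrix.fromCols_mul_fromBlocks, Matrix.one_mul, Matrix.mul_zero,
    add_zero, Matrix.mul_zero, zero_add, Matrix.neg_mul, Matrix.one_mul]

/-- Reading `[G | −1] ∘ e₂⁻¹` at a ring homomorphism `φ`: `[φ(G) | −1] ∘ e₂⁻¹`. [folklore] -/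
theorem frame_doubling_map {R S : Type*} [CommRing R] [CommRing S] (φ : R →+* S) (G : Matrix (Fin n) (Fin n) R) :
    ((Matrix.fromCols G (-(1 : Matrix (Fin n) (Fin n) R)) : Matrix (Fin n) (Fin n ⊕ Fin n) R).submatrix id (e₂ (n := n)).symm).map φ =
      (Matrix.fromCols (G.map φ) (-(1 : Matrix (Fin n) (Fin n) S)) : Matrix (Fin n) (Fin n ⊕ Fin n) S).submatrix id (e₂ (n := n)).symm := by
  rw [← Matrix.submatrix_map, Matrix.fromCols_map, Matrix.map_neg _ (map_neg φ), Matrix.map_one _ (map_zero φ) (map_one φ)]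

/-! ## §3 Place by place: the coordinates `1`, `g_{ij}` are Plücker coordinates of `ι(g,1)` in absolute value -/

/-- **Finite places: `h_v(1, (g_{ij})) ≤ h_v(π)`** for the Plücker vector `π` of `[G | −1] ∘ e₂⁻¹` (any row index `I`): the coordinate `1` and
every `g_{ij}` occur among the `|π_J|_v` (★ F4 over `L_v`). [cite: GelbartPiatetskishapiroRallis1987, Part A §2] -/
theorem vecFinHeight_one_entries_le_plucker (v : HeightOneSpectrum (𝓞 L))
    (g : UnitaryGroup.adelic (Fp L) L (IsCMField.complexConj L) N (Matrix.diagonal dV)) (I : Set.powersetCard (Fin n) n) :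
    vecFinHeight L v (fun o : Option (Fin N × Fin N) => o.elim 1 fun ij =>
        ((g : GL (Fin N) (AdeleRing (𝓞 L) L)) : Matrix (Fin N) (Fin N) (AdeleRing (𝓞 L) L)) ij.1 ij.2) ≤
      vecFinHeight L v (fun J => compound n ((Matrix.fromCols
          (Matrix.reindex e e (((g : GL (Fin N) (AdeleRing (𝓞 L) L)) : Matrix (Fin N) (Fin N) (AdeleRing (𝓞 L) L)) ⊗ₖ
            (1 : Matrix (Fin 1) (Fin 1) (AdeleRing (𝓞 L) L))))
          (-(1 : Matrix (Fin n) (Fin n) (AdeleRing (𝓞 L) L))) : Matrix (Fin n) (Fin n ⊕ Fin n) (AdeleRing (𝓞 L) L)).submatrix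
        id (e₂ (n := n)).symm) I J) := by
  set φ : AdeleRing (𝓞 L) L →+* v.adicCompletion L := AdelicGroupData.adeleEval L v with hφ
  set G : Matrix (Fin n) (Fin n) (AdeleRing (𝓞 L) L) :=
    Matrix.reindex e e (((g : GL (Fin N) (AdeleRing (𝓞 L) L)) : Matrix (Fin N) (Fin N) (AdeleRing (𝓞 L) L)) ⊗ₖ
      (1 : Matrix (Fin 1) (Fin 1) (AdeleRing (𝓞 L) L))) with hG
  set A : Matrix (Fin n) (Fin (n + n)) (AdeleRing (𝓞 L) L) :=
    (Matrix.fromCols G (-(1 : Matrix (Fin n) (Fin n) (AdeleRing (𝓞 L) L))) :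
      Matrix (Fin n) (Fin n ⊕ Fin n) (AdeleRing (𝓞 L) L)).submatrix id (e₂ (n := n)).symm with hA
  set π : Set.powersetCard (Fin (n + n)) n → AdeleRing (𝓞 L) L := fun J => compound n A I J with hπ
  have hAφ : A.map φ = (Matrix.fromCols (G.map φ) (-(1 : Matrix (Fin n) (Fin n) (v.adicCompletion L))) :
      Matrix (Fin n) (Fin n ⊕ Fin n) (v.adicCompletion L)).submatrix id (e₂ (n := n)).symm := frame_doubling_map φ G
  have hcoord : ∀ J, ‖φ (compound n A I J)‖ ≤ (vecFinHeight L v π : ℝ) := fun J => by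
    have h := nnnorm_snd_apply_le_vecFinHeight v π J
    rw [← NNReal.coe_le_coe, coe_nnnorm] at h
    exact h
  refine Finset.sup_le fun c _ => ?_
  rw [← NNReal.coe_le_coe, coe_nnnorm]
  rcases c with _ | ⟨i, j⟩
  · obtain ⟨J, hJ⟩ := exists_compound_fromCols_neg_one_norm_eq_one (card_fin_eq n) (e₂ (n := n)) (G.map φ) I
    show ‖((1 : AdeleRing (𝓞 L) L).2 v)‖ ≤ _
    rw [show ((1 : AdeleRing (𝓞 L) L).2 v) = 1 from rfl, norm_one, ← hJ, ← hAφ, ← map_compound_apply]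
    exact hcoord J
  · obtain ⟨J, hJ⟩ := exists_compound_fromCols_neg_one_norm_eq_entry (card_fin_eq n) (e₂ (n := n)) (G.map φ) I (e (i, 0)) (e (j, 0))
    rw [Matrix.map_apply, hG, reindex_kronecker_one_apply] at hJ
    show ‖((((g : GL (Fin N) (AdeleRing (𝓞 L) L)) : Matrix (Fin N) (Fin N) (AdeleRing (𝓞 L) L)) i j).2 v)‖ ≤ _
    rw [show ((((g : GL (Fin N) (AdeleRing (𝓞 L) L)) : Matrix (Fin N) (Fin N) (AdeleRing (𝓞 L) L)) i j).2 v) =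
      φ ((((g : GL (Fin N) (AdeleRing (𝓞 L) L)) : Matrix (Fin N) (Fin N) (AdeleRing (𝓞 L) L)) i j)) from rfl, ← hJ, ← hAφ,
      ← map_compound_apply]
    exact hcoord J

/-- **Infinite places: every coordinate of `(1, (g_{ij}))` has `w`-norm at most `‖π‖_w`** (same reason, ★ F4 over `L_w`).
[cite: GelbartPiatetskishapiroRallis1987, Part A §2] -/
theorem nnnorm_one_entries_le_vecArchNorm_plucker (w : InfinitePlace L)
    (g : UnitaryGroup.adelic (Fp L) L (IsCMField.complexConj L) N (Matrix.diagonal dV)) (I : Set.powersetCard (Fin n) n)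
    (c : Option (Fin N × Fin N)) :
    ‖((fun o : Option (Fin N × Fin N) => o.elim (1 : AdeleRing (𝓞 L) L) fun ij =>
        ((g : GL (Fin N) (AdeleRing (𝓞 L) L)) : Matrix (Fin N) (Fin N) (AdeleRing (𝓞 L) L)) ij.1 ij.2) c).1 w‖₊ ≤
      vecArchNorm L w (fun J => compound n ((Matrix.fromCols
          (Matrix.reindex e e (((g : GL (Fin N) (AdeleRing (𝓞 L) L)) : Matrix (Fin N) (Fin N) (AdeleRing (𝓞 L) L)) ⊗ₖ
            (1 : Matrix (Fin 1) (Fin 1) (AdeleRing (𝓞 L) L))))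
          (-(1 : Matrix (Fin n) (Fin n) (AdeleRing (𝓞 L) L))) : Matrix (Fin n) (Fin n ⊕ Fin n) (AdeleRing (𝓞 L) L)).submatrix
        id (e₂ (n := n)).symm) I J) := by
  set φ : AdeleRing (𝓞 L) L →+* w.Completion :=
    (Pi.evalRingHom (fun w : InfinitePlace L => w.Completion) w).comp (RingHom.fst (InfiniteAdeleRing L) (FiniteAdeleRing (𝓞 L) L))
    with hφ
  set G : Matrix (Fin n) (Fin n) (AdeleRing (𝓞 L) L) :=
    Matrix.reindex e e (((g : GL (Fin N) (AdeleRing (𝓞 L) L)) : Matrix (Fin N) (Fin N) (AdeleRing (𝓞 L) L)) ⊗ₖ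
      (1 : Matrix (Fin 1) (Fin 1) (AdeleRing (𝓞 L) L))) with hG
  set A : Matrix (Fin n) (Fin (n + n)) (AdeleRing (𝓞 L) L) :=
    (Matrix.fromCols G (-(1 : Matrix (Fin n) (Fin n) (AdeleRing (𝓞 L) L))) :
      Matrix (Fin n) (Fin n ⊕ Fin n) (AdeleRing (𝓞 L) L)).submatrix id (e₂ (n := n)).symm with hA
  set π : Set.powersetCard (Fin (n + n)) n → AdeleRing (𝓞 L) L := fun J => compound n A I J with hπ
  have hAφ : A.map φ = (Matrix.fromCols (G.map φ) (-(1 : Matrix (Fin n) (Fin n) w.Completion)) :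
      Matrix (Fin n) (Fin n ⊕ Fin n) w.Completion).submatrix id (e₂ (n := n)).symm := frame_doubling_map φ G
  have hcoord : ∀ J, ‖φ (compound n A I J)‖ ≤ (vecArchNorm L w π : ℝ) := fun J => by
    have h := nnnorm_fst_apply_le_vecArchNorm w π J
    rw [← NNReal.coe_le_coe, coe_nnnorm] at h
    exact h
  rw [← NNReal.coe_le_coe, coe_nnnorm]
  rcases c with _ | ⟨i, j⟩
  · obtain ⟨J, hJ⟩ := exists_compound_fromCols_neg_one_norm_eq_one (card_fin_eq n) (e₂ (n := n)) (G.map φ) I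
    show ‖((1 : AdeleRing (𝓞 L) L).1 w)‖ ≤ _
    rw [show ((1 : AdeleRing (𝓞 L) L).1 w) = 1 from rfl, norm_one, ← hJ, ← hAφ, ← map_compound_apply]
    exact hcoord J
  · obtain ⟨J, hJ⟩ := exists_compound_fromCols_neg_one_norm_eq_entry (card_fin_eq n) (e₂ (n := n)) (G.map φ) I (e (i, 0)) (e (j, 0))
    rw [Matrix.map_apply, hG, reindex_kronecker_one_apply] at hJ
    show ‖((((g : GL (Fin N) (AdeleRing (𝓞 L) L)) : Matrix (Fin N) (Fin N) (AdeleRing (𝓞 L) L)) i j).1 w)‖ ≤ _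
    rw [show ((((g : GL (Fin N) (AdeleRing (𝓞 L) L)) : Matrix (Fin N) (Fin N) (AdeleRing (𝓞 L) L)) i j).1 w) =
      φ ((((g : GL (Fin N) (AdeleRing (𝓞 L) L)) : Matrix (Fin N) (Fin N) (AdeleRing (𝓞 L) L)) i j)) from rfl, ← hJ, ← hAφ,
      ← map_compound_apply]
    exact hcoord J

/-- **`h(1, (g_{ij})) ≤ C₁ · h(π(ι(g,1)))`**, `C₁ = ∏_w √(N² + 1)^{mult w}`, for the Plücker vector `π(ι(g,1))` of the height of record (row `I` of
`(R₀ · ι(g,1))^{(n)}`; §2–§3 place by place, then §1). [cite: GelbartPiatetskishapiroRallis1987, Part A §2] [cite: Garrett2018, §2.2 (PDF p. 81)] -/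
theorem vecHeight_one_entries_le_plucker (g : UnitaryGroup.adelic (Fp L) L (IsCMField.complexConj L) N (Matrix.diagonal dV))
    (I : Set.powersetCard (Fin n) n) :
    vecHeight L (fun o : Option (Fin N × Fin N) => o.elim 1 fun ij =>
        ((g : GL (Fin N) (AdeleRing (𝓞 L) L)) : Matrix (Fin N) (Fin N) (AdeleRing (𝓞 L) L)) ij.1 ij.2) ≤
      (∏ w : InfinitePlace L, NNReal.sqrt (Fintype.card (Option (Fin N × Fin N))) ^ w.mult) *
        vecHeight L (fun J => compound n ((Matrix.fromCols (1 : Matrix (Fin n) (Fin n) (AdeleRing (𝓞 L) L))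
          (-(1 : Matrix (Fin n) (Fin n) (AdeleRing (𝓞 L) L))) : Matrix (Fin n) (Fin n ⊕ Fin n) (AdeleRing (𝓞 L) L)).submatrix id
            (e₂ (n := n)).symm *
          (((iotaLeft L e dV hdV dW hdW g : HA L e dV hdV dW hdW) : GL (Fin (n + n)) (AdeleRing (𝓞 L) L)) :
            Matrix (Fin (n + n)) (Fin (n + n)) (AdeleRing (𝓞 L) L))) I J) := by
  have hfin : IsHeightFinite L (fun J => compound n ((Matrix.fromCols (1 : Matrix (Fin n) (Fin n) (AdeleRing (𝓞 L) L))
      (-(1 : Matrix (Fin n) (Fin n) (AdeleRing (𝓞 L) L))) : Matrix (Fin n) (Fin n ⊕ Fin n) (AdeleRing (𝓞 L) L)).submatrix id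
        (e₂ (n := n)).symm *
      (((iotaLeft L e dV hdV dW hdW g : HA L e dV hdV dW hdW) : GL (Fin (n + n)) (AdeleRing (𝓞 L) L)) :
        Matrix (Fin (n + n)) (Fin (n + n)) (AdeleRing (𝓞 L) L))) I J) := by
    rw [pluckerVec_eq_principalVec_vecMul L e dV hdV dW hdW _ I]
    exact isHeightFinite_principalVec_vecMul_compound L (frame_compound_row_ne_zero L I) _
  rw [frame_mul_coe_iotaLeft] at hfin ⊢
  exact vecHeight_le_of_local (isHeightFinite_of_apply_eq_one none rfl) hfin
    (fun v => vecFinHeight_one_entries_le_plucker L e dV v g I)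
    (fun w c => nnnorm_one_entries_le_vecArchNorm_plucker L e dV w g I c)

/-! ## §4 The Plücker height of record decays along `ι(·,1)` -/

/-- **THE HEIGHT OF RECORD WITH DECAY.**  For non-degenerate data (`N ≥ 1`) the Plücker height of record `Φ₀(x) = h_L(ξ₀ · x^{(n)})^{-1∕2}`
(★ p09 `exists_siegelHeight`, ★ p07 `exists_siegelHeight_continuous`; its properties (0) continuity, (1) positivity, (2) type `(P_Δ, modDelta)`
re-run here for the NAMED formula — adapted from ★ p854922 ∕ p854993) satisfies **`Φ₀(ι(g,1)) ≤ C · ‖g‖^{-1∕4}`** on `U(V)(𝔸)`: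
`‖g‖ ≤ h(1,g,g⁻¹) ≤ C₂ h(1,g)² ≤ C₂ C₁² h(π(ι(g,1)))²` (★ F3, ★ F5, §3). [cite: GelbartPiatetskishapiroRallis1987, Part A §2]
[cite: Liu2021, Lem. B.10 (2) p. 102] [cite: BorelJacquet1979, §1.2] -/
theorem exists_continuous_height_decay [NeZero N] (hdV0 : ∀ i, dV i ≠ 0) (hdW0 : ∀ i, dW i ≠ 0) :
    ∃ Φ₀ : HA L e dV hdV dW hdW → ℝ, Continuous Φ₀ ∧ (∀ x, 0 < Φ₀ x) ∧
      (∀ p x : HA L e dV hdV dW hdW, IsSiegelDelta L e dV hdV dW hdW p →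
        Φ₀ (p * x) = modDelta L e dV hdV dW hdW p * Φ₀ x) ∧
      ∃ C : ℝ, 0 < C ∧ ∀ g : UnitaryGroup.adelic (Fp L) L (IsCMField.complexConj L) N (Matrix.diagonal dV),
        Φ₀ (iotaLeft L e dV hdV dW hdW g) ≤ C * adelicHeightGL N L (g : GL (Fin N) (AdeleRing (𝓞 L) L)) ^ (-(1 / 4 : ℝ)) := by
  classical
  -- the rational frame row `ξ₀` and the Plücker vector `π(x) = ξ₀ · x^{(n)}` (adapted from ★ p854922 ∕ p854993)
  set R₀L : Matrix (Fin n) (Fin (n + n)) L :=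
    (Matrix.fromCols (1 : Matrix (Fin n) (Fin n) L) (-(1 : Matrix (Fin n) (Fin n) L)) :
      Matrix (Fin n) (Fin n ⊕ Fin n) L).submatrix id (e₂ (n := n)).symm with hR₀L
  have hcard : (Finset.univ : Finset (Fin n)).card = n := by rw [Finset.card_univ, Fintype.card_fin]
  set I₁ : Set.powersetCard (Fin n) n := Set.powersetCard.ofCard hcard with hI₁
  set ξ₀ : Set.powersetCard (Fin (n + n)) n → L := fun J => compound n R₀L I₁ J with hξ₀
  have hξ₀ne : ξ₀ ≠ 0 := frame_compound_row_ne_zero L I₁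
  set π : HA L e dV hdV dW hdW → Set.powersetCard (Fin (n + n)) n → AdeleRing (𝓞 L) L := fun x =>
    principalVec L ξ₀ ᵥ* compound n ((x : GL (Fin (n + n)) (AdeleRing (𝓞 L) L)) : Matrix (Fin (n + n)) (Fin (n + n)) (AdeleRing (𝓞 L) L))
    with hπ
  have hπrow : ∀ x : HA L e dV hdV dW hdW, (fun J => compound n ((Matrix.fromCols (1 : Matrix (Fin n) (Fin n) (AdeleRing (𝓞 L) L))
      (-(1 : Matrix (Fin n) (Fin n) (AdeleRing (𝓞 L) L))) : Matrix (Fin n) (Fin n ⊕ Fin n) (AdeleRing (𝓞 L) L)).submatrix id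
        (e₂ (n := n)).symm * ((x : GL (Fin (n + n)) (AdeleRing (𝓞 L) L)) : Matrix (Fin (n + n)) (Fin (n + n)) (AdeleRing (𝓞 L) L))) I₁ J) =
      π x := fun x => pluckerVec_eq_principalVec_vecMul L e dV hdV dW hdW x I₁
  -- the height and `Φ₀`
  set H : HA L e dV hdV dW hdW → ℝ≥0 := fun x => vecHeight L (π x) with hH
  have hHpos : ∀ x, 0 < H x := fun x => vecHeight_principalVec_vecMul_compound_pos L hξ₀ne _
  have hHfin : ∀ x, IsHeightFinite L (π x) := fun x => isHeightFinite_principalVec_vecMul_compound L hξ₀ne _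
  have hHcont : Continuous H :=
    (continuous_vecHeight_vecMul_compound L (principalVec L ξ₀)).comp continuous_subtype_val
  refine ⟨fun x => ((H x : ℝ)) ^ (-(1 / 2 : ℝ)), ?_, fun x => Real.rpow_pos_of_pos (NNReal.coe_pos.2 (hHpos x)) _, ?_, ?_⟩
  · -- (0) continuity
    exact (NNReal.continuous_coe.comp hHcont).rpow_const fun x => Or.inl (NNReal.coe_pos.2 (hHpos x)).ne'
  · -- (2) type `(P_Δ, modDelta)` (adapted from ★ p854922)
    intro p x hp
    have hΔ : IsUnit (detDelta L e dV hdV dW hdW p) := isUnit_detDelta_of_isSiegelDelta L e dV hdV dW hdW p hp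
    have hD := isUnit_det_D L e dV hdV dW hdW hp
    -- `π(p x) = det D_p • π(x)`
    have hπp : π (p * x) = ((hD.unit : (AdeleRing (𝓞 L) L)ˣ) : AdeleRing (𝓞 L) L) • π x := by
      rw [← hπrow (p * x), ← hπrow x]
      funext J
      rw [Pi.smul_apply, smul_eq_mul, IsUnit.unit_spec, Subgroup.coe_mul, Units.val_mul, ← Matrix.mul_assoc,
        frame_mul_coe_of_isSiegelDelta L e dV hdV dW hdW hp, Matrix.mul_assoc,
        compound_mul_apply_of_card_eq (card_fin_eq n)]
    have hHp : H (p * x) = IdeleClassGroup.ideleNorm L hD.unit * H x := by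
      rw [hH]; dsimp only; rw [hπp, vecHeight_smul (hHfin x)]
    have hnorm := ideleNorm_detDelta_mul_ideleNorm_det_D L e dV hdV dW hdW hdV0 hdW0 hp hΔ hD
    have hDinv : IdeleClassGroup.ideleNorm L hD.unit = (IdeleClassGroup.ideleNorm L hΔ.unit)⁻¹ :=
      eq_inv_of_mul_eq_one_right hnorm
    have hmod : modDelta L e dV hdV dW hdW p = Real.sqrt (IdeleClassGroup.ideleNorm L hΔ.unit : ℝ) := by
      rw [modDelta, dif_pos hΔ, coe_ideleNorm]
    dsimp only
    rw [hHp, hDinv, NNReal.coe_mul, NNReal.coe_inv, hmod, Real.sqrt_eq_rpow,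
      Real.mul_rpow (inv_nonneg.2 (NNReal.coe_nonneg _)) (NNReal.coe_nonneg _), Real.inv_rpow (NNReal.coe_nonneg _),
      Real.rpow_neg (NNReal.coe_nonneg _), inv_inv]
  · -- decay along `ι(·,1)`
    obtain ⟨C₂, hC₂⟩ := vecHeight_one_entries_inv_le L dV hdV0
    set C₁ : ℝ≥0 := ∏ w : InfinitePlace L, NNReal.sqrt (Fintype.card (Option (Fin N × Fin N))) ^ w.mult with hC₁
    have hC₁pos : 0 < C₁ :=
      Finset.prod_pos fun w _ => pow_pos (NNReal.sqrt_pos.2 (Nat.cast_pos.2 Fintype.card_pos)) _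
    set c : ℝ := max (C₂ : ℝ) 1 * (C₁ : ℝ) ^ 2 with hc
    have hcpos : 0 < c := mul_pos (lt_of_lt_of_le one_pos (le_max_right _ _)) (pow_pos (NNReal.coe_pos.2 hC₁pos) 2)
    refine ⟨c ^ (1 / 4 : ℝ), Real.rpow_pos_of_pos hcpos _, fun g => ?_⟩
    -- `‖g‖ ≤ h(1,g,g⁻¹) ≤ C₂ h(1,g)² ≤ C₂ (C₁ H)²`
    have hapos : 0 < adelicHeightGL N L (g : GL (Fin N) (AdeleRing (𝓞 L) L)) :=
      adelicHeightGL_pos_holds (g : GL (Fin N) (AdeleRing (𝓞 L) L))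
    have hx : vecHeight L (fun o : Option (Fin N × Fin N) => o.elim 1 fun ij =>
        ((g : GL (Fin N) (AdeleRing (𝓞 L) L)) : Matrix (Fin N) (Fin N) (AdeleRing (𝓞 L) L)) ij.1 ij.2) ≤
        C₁ * H (iotaLeft L e dV hdV dW hdW g) := by
      have h := vecHeight_one_entries_le_plucker L e dV hdV dW hdW g I₁
      rw [hπrow] at h
      exact h
    have hy := hC₂ g
    have hg := adelicHeightGL_le_vecHeight (K := L) ((g : GL (Fin N) (AdeleRing (𝓞 L) L)))
    have h1 : adelicHeightGL N L (g : GL (Fin N) (AdeleRing (𝓞 L) L)) ≤ c * (H (iotaLeft L e dV hdV dW hdW g) : ℝ) ^ 2 := by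
      refine hg.trans ?_
      have h2 : (vecHeight L (Sum.elim (fun o : Option (Fin N × Fin N) => o.elim 1 fun ij => ((g : GL (Fin N) (AdeleRing (𝓞 L) L)) :
            Matrix (Fin N) (Fin N) (AdeleRing (𝓞 L) L)) ij.1 ij.2)
          (fun ik : Fin N × Fin N => (((g⁻¹ : UnitaryGroup.adelic (Fp L) L (IsCMField.complexConj L) N (Matrix.diagonal dV)) :
            GL (Fin N) (AdeleRing (𝓞 L) L)) : Matrix (Fin N) (Fin N) (AdeleRing (𝓞 L) L)) ik.1 ik.2) :
          Option (Fin N × Fin N) ⊕ (Fin N × Fin N) → AdeleRing (𝓞 L) L) : ℝ) ≤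
          max (C₂ : ℝ) 1 * ((C₁ : ℝ) * (H (iotaLeft L e dV hdV dW hdW g) : ℝ)) ^ 2 := by
        have hy' : (vecHeight L (Sum.elim (fun o : Option (Fin N × Fin N) => o.elim 1 fun ij => ((g : GL (Fin N) (AdeleRing (𝓞 L) L)) :
            Matrix (Fin N) (Fin N) (AdeleRing (𝓞 L) L)) ij.1 ij.2)
          (fun ik : Fin N × Fin N => (((g⁻¹ : UnitaryGroup.adelic (Fp L) L (IsCMField.complexConj L) N (Matrix.diagonal dV)) :
            GL (Fin N) (AdeleRing (𝓞 L) L)) : Matrix (Fin N) (Fin N) (AdeleRing (𝓞 L) L)) ik.1 ik.2) :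
          Option (Fin N × Fin N) ⊕ (Fin N × Fin N) → AdeleRing (𝓞 L) L) : ℝ) ≤
            (C₂ : ℝ) * (vecHeight L (fun o : Option (Fin N × Fin N) => o.elim 1 fun ij =>
              ((g : GL (Fin N) (AdeleRing (𝓞 L) L)) : Matrix (Fin N) (Fin N) (AdeleRing (𝓞 L) L)) ij.1 ij.2) : ℝ) ^ 2 := by
          exact_mod_cast hy
        have hx' : (vecHeight L (fun o : Option (Fin N × Fin N) => o.elim 1 fun ij =>
              ((g : GL (Fin N) (AdeleRing (𝓞 L) L)) : Matrix (Fin N) (Fin N) (AdeleRing (𝓞 L) L)) ij.1 ij.2) : ℝ) ≤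
            (C₁ : ℝ) * (H (iotaLeft L e dV hdV dW hdW g) : ℝ) := by exact_mod_cast hx
        refine hy'.trans ?_
        exact mul_le_mul (le_max_left _ _) (pow_le_pow_left₀ (NNReal.coe_nonneg _) hx' 2) (sq_nonneg _) (le_trans zero_le_one (le_max_right _ _))
      refine h2.trans (le_of_eq ?_)
      rw [hc]; ring
    -- `H^{-1/2} = (H²)^{-1/4} ≤ (‖g‖/c)^{-1/4} = c^{1/4} ‖g‖^{-1/4}`
    have hHg : 0 < (H (iotaLeft L e dV hdV dW hdW g) : ℝ) := NNReal.coe_pos.2 (hHpos _)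
    have hdiv : adelicHeightGL N L (g : GL (Fin N) (AdeleRing (𝓞 L) L)) / c ≤ (H (iotaLeft L e dV hdV dW hdW g) : ℝ) ^ 2 := by
      rw [div_le_iff₀ hcpos, mul_comm]; exact h1
    dsimp only
    calc ((H (iotaLeft L e dV hdV dW hdW g) : ℝ)) ^ (-(1 / 2 : ℝ))
        = (((H (iotaLeft L e dV hdV dW hdW g) : ℝ)) ^ 2) ^ (-(1 / 4 : ℝ)) := by
          rw [← Real.rpow_natCast _ 2, ← Real.rpow_mul hHg.le]; norm_num
      _ ≤ (adelicHeightGL N L (g : GL (Fin N) (AdeleRing (𝓞 L) L)) / c) ^ (-(1 / 4 : ℝ)) :=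
          Real.rpow_le_rpow_of_nonpos (div_pos hapos hcpos) hdiv (by norm_num)
      _ = c ^ (1 / 4 : ℝ) * adelicHeightGL N L (g : GL (Fin N) (AdeleRing (𝓞 L) L)) ^ (-(1 / 4 : ℝ)) := by
          rw [Real.div_rpow hapos.le hcpos.le, Real.rpow_neg hcpos.le, div_inv_eq_mul, mul_comm]

end Doubling

/-! ## §5 Socket #16a BY NAME -/

/-- **PAYMENT OF `sig_K2LiuDoublingHeightDecayPointwise`** (socket #16a of unit U5 «DOUBLING ZETA» of the K2_Liu road,
`Cruxes/HLiu418/Lines/K2_Liu_CurveThetaSigs_U5_DoublingZeta.lean` ED. 6 :242, TOKEN FOR TOKEN).  **HEIGHT DECAY ALONG THE DOUBLING EMBEDDING**: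
for non-degenerate hermitian data over a CM field (`N ≥ 1`) and every continuous positive `Φ : H(𝔸) → ℝ` of type `(P_Δ, |det_Δ|^{1∕2})` there are
`C, α > 0` with `Φ(ι(g,1)) ≤ C · ‖g‖^{-α}` for all `g ∈ U(V)(𝔸)` (`α = 1∕4`): `Φ ≤ C' Φ₀` for the height of record (★ p854882 over the Iwasawa
decomposition ★ (I)), and `Φ₀` decays (§4). [cite: GelbartPiatetskishapiroRallis1987, Part A §2] [cite: Liu2021, Lem. B.10 (2) p. 102]
[cite: BorelJacquet1979, §1.2 and §4.2] -/
theorem doublingHeightDecayPointwise :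
    ∀ (L : Type) [Field L] [NumberField L] [IsCMField L] {N n : ℕ} [NeZero N] (e : Fin N × Fin 1 ≃ Fin n)
      (dV : Fin N → L) (hdV : ∀ i, IsCMField.complexConj L (dV i) = dV i) (_hdV0 : ∀ i, dV i ≠ 0)
      (dW : Fin 1 → L) (hdW : ∀ i, IsCMField.complexConj L (dW i) = dW i) (_hdW0 : ∀ i, dW i ≠ 0)
      (Φ : HA L e dV hdV dW hdW → ℝ), Continuous Φ → (∀ x, 0 < Φ x) →
      (∀ p x : HA L e dV hdV dW hdW, IsSiegelDelta L e dV hdV dW hdW p →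
        Φ (p * x) = modDelta L e dV hdV dW hdW p * Φ x) →
      ∃ C α : ℝ, 0 < C ∧ 0 < α ∧
        ∀ g : UnitaryGroup.adelic (Fp L) L (IsCMField.complexConj L) N (Matrix.diagonal dV),
          Φ (iotaLeft L e dV hdV dW hdW g) ≤ C * adelicHeightGL N L (g : GL (Fin N) (AdeleRing (𝓞 L) L)) ^ (-α) := by
  intro L _ _ _ N n _ e dV hdV hdV0 dW hdW hdW0 Φ hΦc hΦpos hΦ
  obtain ⟨K, hK, hPK⟩ := K2LiuSiegelDoubledIwasawaCompact.exists_isCompact_isSiegelDelta_mul L e dV hdV dW hdW hdV0 hdW0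
  obtain ⟨Φ₀, h0c, h0pos, h0Δ, C₀, hC₀, hdecay⟩ := exists_continuous_height_decay L e dV hdV dW hdW hdV0 hdW0
  obtain ⟨C', hC', hle⟩ :=
    K2LiuDoublingHeightComparison.exists_pos_forall_le_mul L e dV hdV dW hdW hK hPK hΦc h0c h0pos hΦ h0Δ
  refine ⟨C' * C₀, 1 / 4, mul_pos hC' hC₀, by norm_num, fun g => ?_⟩
  calc Φ (iotaLeft L e dV hdV dW hdW g) ≤ C' * Φ₀ (iotaLeft L e dV hdV dW hdW g) := hle _
    _ ≤ C' * (C₀ * adelicHeightGL N L (g : GL (Fin N) (AdeleRing (𝓞 L) L)) ^ (-(1 / 4 : ℝ))) :=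
        mul_le_mul_of_nonneg_left (hdecay g) hC'.le
    _ = C' * C₀ * adelicHeightGL N L (g : GL (Fin N) (AdeleRing (𝓞 L) L)) ^ (-(1 / 4 : ℝ)) := by ring

end Summit.HodgeConjecture.HodgeConjecture.Cruxes.HLiu418.K2LiuDoublingHeightDecayPointwise

end
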